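import Mathlib
import HarnessLib
import Summits.AnomalousDissipation.AnomalousDissipation.Theses.DyadicWallCascade

/-!
# Stub `stub_fluxNeg` of line `Sketch` — crux stmt-AnomalousDissipation-17917 (`ViscousContinuation`)

This file proves the registered stub `stub_fluxNeg` of line `Sketch` of the crux
stmt-AnomalousDissipation-17917 (`DyadicWallCascade.ViscousContinuation`): the flux-sign
normalisation of a half-space hierarchy.

Steady Euler is symmetric under `V ↦ −V` with the SAME pressure `Q`
(`(−V·∇)(−V) = (V·∇)V`, i.e. `fderiv (−V) X (−V X) = fderiv V X (V X)`); smoothness, the sup bounds,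
the divergence-free condition, degree-0 dilation invariance and band periodicity are preserved, the
mass flux `∫ V₃` through the unit square of `{z = 1}` stays `0`, and the energy flux
`F = ∫ V₃ (|V|²/2 + Q)` flips sign.  Hence a half-space hierarchy (route decl `HalfSpaceHierarchy`,
energy flux `F ≠ 0`) may be taken with `F < 0` without loss of generality — the sign the viscous
continuation forces (energy flows in from `z = +∞`).

Proof: destructure the hierarchy `(V, Q, C, F)`; if `F < 0` return it verbatim, otherwise return
`(−V, Q, C, −F)` and check the ten clauses one by one (`fderiv_fun_neg`, `norm_neg`,
`MeasureTheory.integral_neg`).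
-/

-- `Summit.<Summit>.<Problem>`: single-conjunct summit, the duplicate namespace is mandated (CONVENTIONS §2).
set_option linter.dupNamespace false

noncomputable section

namespace Summit.AnomalousDissipation.AnomalousDissipation.Theorems

open MeasureTheory
open Summit.AnomalousDissipation.AnomalousDissipation.Theses.DyadicWallCascade

/-- Euclidean 3-space (local notation, as in the registered skeleton). -/
local notation "E³" => EuclideanSpace ℝ (Fin 3)

/-- **Flux-sign normalisation of a half-space hierarchy** (registered stub `stub_fluxNeg` of line
`Sketch`, crux stmt-AnomalousDissipation-17917).  If a half-space hierarchy exists (bounded smooth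
steady Euler flow `(V, Q)` on `{z > 0}`, divergence free, degree-0 dilation invariant, band-periodic,
zero mass flux and energy flux `F ≠ 0` through the unit square at `z = 1`), then one exists with
`F < 0`: steady Euler is `V ↦ −V` symmetric with the same pressure, the mass flux stays `0` and the
energy flux flips sign. [folklore] -/
theorem stub_fluxNeg :
    HalfSpaceHierarchy →
      ∃ (V : E³ → E³) (Q : E³ → ℝ) (C F : ℝ),
        ContDiffOn ℝ ((⊤ : ℕ∞) : WithTop ℕ∞) V {X : E³ | 0 < X 2} ∧
        ContDiffOn ℝ ((⊤ : ℕ∞) : WithTop ℕ∞) Q {X : E³ | 0 < X 2} ∧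
        (∀ X : E³, 0 < X 2 → ‖V X‖ ≤ C ∧ |Q X| ≤ C) ∧
        (∀ X : E³, 0 < X 2 → ∑ i : Fin 3, (fderiv ℝ V X (EuclideanSpace.single i (1 : ℝ))) i = 0) ∧
        (∀ X : E³, 0 < X 2 → (fderiv ℝ V X) (V X) + gradient Q X = 0) ∧
        (∀ X : E³, 0 < X 2 → V ((2 : ℝ) • X) = V X ∧ Q ((2 : ℝ) • X) = Q X) ∧
        (∀ X : E³, 1 ≤ X 2 → X 2 ≤ 2 →
          V (X + EuclideanSpace.single 0 (1 : ℝ)) = V X ∧ V (X + EuclideanSpace.single 1 (1 : ℝ)) = V X ∧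
          Q (X + EuclideanSpace.single 0 (1 : ℝ)) = Q X ∧ Q (X + EuclideanSpace.single 1 (1 : ℝ)) = Q X) ∧
        (∫ q in Set.Icc (0 : ℝ) 1 ×ˢ Set.Icc (0 : ℝ) 1, (V !₂[q.1, q.2, (1 : ℝ)]) 2 = 0) ∧
        F < 0 ∧
        (∫ q in Set.Icc (0 : ℝ) 1 ×ˢ Set.Icc (0 : ℝ) 1,
          (V !₂[q.1, q.2, (1 : ℝ)]) 2 * (‖V !₂[q.1, q.2, (1 : ℝ)]‖ ^ 2 / 2 + Q !₂[q.1, q.2, (1 : ℝ)]) = F) := by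
  intro h
  obtain ⟨V, Q, C, F, hV, hQ, hbd, hdiv, heul, hdil, hper, hmass, hF, hflux⟩ := h
  rcases hF.lt_or_gt with hneg | hpos
  · -- the flux is already negative: return the hierarchy verbatim
    exact ⟨V, Q, C, F, hV, hQ, hbd, hdiv, heul, hdil, hper, hmass, hneg, hflux⟩
  · -- the flux is positive: reverse the flow, `V ↦ -V`, same pressure
    -- (3) sup bounds
    have h3 : ∀ X : E³, 0 < X 2 → ‖-V X‖ ≤ C ∧ |Q X| ≤ C := fun X hX => by
      rw [norm_neg]
      exact hbd X hX
    -- (4) divergence free: `fderiv (-V) X = -fderiv V X`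
    have h4 : ∀ X : E³, 0 < X 2 →
        ∑ i : Fin 3, (fderiv ℝ (fun Y => -V Y) X (EuclideanSpace.single i (1 : ℝ))) i = 0 := by
      intro X hX
      simpa only [fderiv_fun_neg, IsNegApply.neg_apply, PiLp.neg_apply,
        Finset.sum_neg_distrib, neg_eq_zero] using hdiv X hX
    -- (5) steady Euler with the same pressure: `(-DV)(-V) = DV V`
    have h5 : ∀ X : E³, 0 < X 2 → (fderiv ℝ (fun Y => -V Y) X) (-V X) + gradient Q X = 0 := by
      intro X hX
      rw [fderiv_fun_neg, IsNegApply.neg_apply, map_neg, neg_neg]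
      exact heul X hX
    -- (6) degree-0 dilation invariance
    have h6 : ∀ X : E³, 0 < X 2 → -V ((2 : ℝ) • X) = -V X ∧ Q ((2 : ℝ) • X) = Q X :=
      fun X hX => ⟨congrArg Neg.neg (hdil X hX).1, (hdil X hX).2⟩
    -- (7) band periodicity
    have h7 : ∀ X : E³, 1 ≤ X 2 → X 2 ≤ 2 →
        -V (X + EuclideanSpace.single 0 (1 : ℝ)) = -V X ∧
          -V (X + EuclideanSpace.single 1 (1 : ℝ)) = -V X ∧
          Q (X + EuclideanSpace.single 0 (1 : ℝ)) = Q X ∧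
          Q (X + EuclideanSpace.single 1 (1 : ℝ)) = Q X :=
      fun X h₁ h₂ => ⟨congrArg Neg.neg (hper X h₁ h₂).1, congrArg Neg.neg (hper X h₁ h₂).2.1,
        (hper X h₁ h₂).2.2.1, (hper X h₁ h₂).2.2.2⟩
    -- (8) zero mass flux
    have h8 : (∫ q in Set.Icc (0 : ℝ) 1 ×ˢ Set.Icc (0 : ℝ) 1, (-V !₂[q.1, q.2, (1 : ℝ)]) 2) = 0 := by
      simpa only [PiLp.neg_apply, integral_neg, neg_eq_zero] using hmass
    -- (9) the new flux `-F` is negative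
    have h9 : -F < 0 := by linarith
    -- (10) the energy flux flips sign
    have hflux' : (∫ q in Set.Icc (0 : ℝ) 1 ×ˢ Set.Icc (0 : ℝ) 1,
        (V !₂[q.1, q.2, (1 : ℝ)]) 2 * (‖V !₂[q.1, q.2, (1 : ℝ)]‖ ^ 2 / 2 + Q !₂[q.1, q.2, (1 : ℝ)])) = F :=
      hflux
    have h10 : (∫ q in Set.Icc (0 : ℝ) 1 ×ˢ Set.Icc (0 : ℝ) 1,
        (-V !₂[q.1, q.2, (1 : ℝ)]) 2 *
          (‖-V !₂[q.1, q.2, (1 : ℝ)]‖ ^ 2 / 2 + Q !₂[q.1, q.2, (1 : ℝ)])) = -F := by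
      simp only [PiLp.neg_apply, norm_neg, neg_mul, integral_neg, hflux']
    exact ⟨fun Y => -V Y, Q, C, -F, hV.neg, hQ, h3, h4, h5, h6, h7, h8, h9, h10⟩

end Summit.AnomalousDissipation.AnomalousDissipation.Theorems
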